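import Literature.Combinatorics.Optimization.RationalPsdRank
import HarnessLib

/-!
# An octahedron of psd rank five (Gouveia–Robinson–Thomas 2013, Example 4.5) — PROVED

Source: J. Gouveia, R. Z. Robinson, R. R. Thomas, *Polytopes of minimum positive semidefinite rank*,
Discrete Comput. Geom. 50 (2013) 679–699 = arXiv:1205.5306 [GouveiaRobinsonThomas2013], §4 (held text
`paper:arxiv-1205.5306`, chunks p10–p11). The survey [FawziEtAl2015] §5.2 (held text
`paper:arxiv-1407.4095` p15) cites the paper for the `dim P + 1` lower bound and the classification of the
polytopes attaining it in `ℝ²` and `ℝ³`; this file proves the example by which GRT show that the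
combinatorial type does not decide psd-minimality in `ℝ³` (listed as "NOT here … Ex. 4.5 (Macaulay2
computations)" in the tree's `PsdMinimalPolytopes.lean`).

The printed text (p10–p11, verbatim). "On the other hand, being combinatorially equivalent to a `2`-level
polytope does not imply minimal psd rank. The regular octahedron in `ℝ³` is a `2`-level polytope but we
now show an octahedron whose psd rank is five. **Example 4.5.** Consider the octahedron with vertices
`(0,0,0),(2,0,0),(0,2,0),(2,2,0),(1,1,-1),(1,2,1)` which has slack matrix:
`[[0,0,0,0,2,2,2,2],[0,2,0,2,0,0,2,2],[2,0,2,0,2,2,0,0],[2,2,2,2,0,0,0,0],[0,2,3,0,0,2,1,0],[3,0,0,2,2,0,0,1]]`.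
It can be checked algebraically as in Example 3.6 that no Hadamard square root of this slack matrix
has rank four. However, the positive Hadamard square root has rank five and hence the psd rank of this
octahedron is five."

Everything is PROVED, for the printed `6 × 8` matrix `S` (`grtOctahedronSlack`):

| printed claim | Lean | status |
|---|---|---|
| `S` is the slack matrix of the six printed vertices (against eight explicit facet inequalities) | `grtOctahedronSlack_eq_slack` | PROVED |
| the zero pattern of `S` is the vertex–facet incidence of an octahedron (facets = the `8` triangles with one vertex from each of the antipodal pairs `{0,3},{1,2},{4,5}`) | `grtOctahedronFacets`, `grtOctahedronN_eq_zero_iff` | PROVED (`decide`) |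
| `rank S = 4` | `rank_grtOctahedronSlack` | PROVED |
| "no Hadamard square root of this slack matrix has rank four" — in fact EVERY Hadamard square root has rank `≥ 5` | `linearIndependent_rows_of_sq_eq_grtOctahedronSlack`, `five_le_rank_of_sq_eq_grtOctahedronSlack`, `not_hasHadamardSqrtOfRankLE_grtOctahedronSlack_four` | PROVED |
| "the positive Hadamard square root has rank five" | `grtOctahedronSqrt`, `grtOctahedronSqrt_eq_sqrt`, `rank_grtOctahedronSqrt` | PROVED |
| "hence the psd rank of this octahedron is five" | `grtOctahedronSlack_factors_rank_le_one`, `not_hasPsdFactorization_grtOctahedronSlack_four`, **`grtOctahedronSlack_psdRank`**, `GouveiaRobinsonThomas2013_ex45` | PROVED |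
| "The regular octahedron in `ℝ³` is a `2`-level polytope" (same combinatorial type, psd rank `4 = 3 + 1`) | `regOctahedronSlack`, `regOctahedronSlack_two_level`, `regOctahedronSlack_eq_zero_iff`, `regOctahedronSlack_psdRank` | PROVED |

How the two non-displayed computations are done here (no computer algebra, no sign-pattern enumeration).
* "psd rank five ⇒": a psd factorization of size `4` of `S` would consist of rank-one factors — for
  every row and every column of `S` there is a triangular `3`-pattern inside the columns (rows) where
  it vanishes, so GRT Prop. 2.6's compression (`rank_rowFactor_add_le_of_triangular`,
  `rank_colFactor_add_le_of_triangular` of the tree's `RationalPsdRank.lean`) forces rank `≤ 4 − 3`;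
  for a genuine slack matrix this is GRT Prop. 3.2 — and rank-one factors give a Hadamard square root of
  rank `≤ 4` (Lemma 2.4 = FGPRT Prop. 6.2, `FawziEtAl2015_prop62_holds`).
* "no Hadamard square root has rank four": for ANY choice of signs, the rows `1,2,3,5,6` of a Hadamard
  square root `N` of `S` are linearly independent. Writing a vanishing combination with coefficients
  `α, β, γ, ε, ζ` and reading the eight columns: columns `1,3` give `2γ² = 3ζ² = 3ε²`, columns `2,4` give
  `β² = ε² = ζ²`; with `μ := ε²`, column `7` gives `2α² = 3μ + 2P` and column `5` gives `2α² = 5μ + 2Q`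
  where `P := βε N₂₇N₅₇`, `Q := γζ N₃₅N₆₅` satisfy `P² = 2μ²`, `Q² = 6μ²`; hence `P − Q = μ`,
  `2PQ = 7μ²`, `48μ⁴ = 4P²Q² = 49μ⁴`, `μ = 0`, and all coefficients vanish. (Numerically: the four
  numbers `3 ± 2√2`, `5 ± 2√6` are pairwise distinct.) So `rank N ≥ 5 > 4`.
* The support of `S` carries NO triangular `5`-pattern (its support-based lower bound is `4`): as for
  the pentagon and hexagon of GRT Ex. 3.6 (tree: `PsdMinimalPolytopes.lean`), the bound `rank_psd ≥ 5`
  is invisible to the zero pattern — the regular octahedron has the same zero pattern and psd rank `4`.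

NOT here: GRT Theorem 4.8 (an octahedron has psd rank four iff it is biplanar) is the companion file
`BiplanarOctahedraPsdRank.lean`; the `ℝ³` classification Lemma 4.9 – Thm. 4.12 is not typed.
-/

noncomputable section

open Matrix Finset
open scoped MatrixOrder

namespace Literature.Combinatorics.Optimization

/-! ### The printed octahedron and its slack matrix -/

/-- The printed slack matrix of Example 4.5, as a table of natural numbers (rows = the six vertices in
the printed order, columns = the eight facets in the printed order).
[cite: GouveiaRobinsonThomas2013, Ex. 4.5 (p10)] -/
def grtOctahedronN : Fin 6 → Fin 8 → ℕ :=
  ![![0, 0, 0, 0, 2, 2, 2, 2], ![0, 2, 0, 2, 0, 0, 2, 2], ![2, 0, 2, 0, 2, 2, 0, 0],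
    ![2, 2, 2, 2, 0, 0, 0, 0], ![0, 2, 3, 0, 0, 2, 1, 0], ![3, 0, 0, 2, 2, 0, 0, 1]]

/-- **The slack matrix of GRT Example 4.5** (p10, verbatim):
`[[0,0,0,0,2,2,2,2],[0,2,0,2,0,0,2,2],[2,0,2,0,2,2,0,0],[2,2,2,2,0,0,0,0],[0,2,3,0,0,2,1,0],[3,0,0,2,2,0,0,1]]`.
[cite: GouveiaRobinsonThomas2013, Ex. 4.5 (p10)] -/
def grtOctahedronSlack : Matrix (Fin 6) (Fin 8) ℝ := fun i j => (grtOctahedronN i j : ℝ)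

/-- The six printed vertices `(0,0,0),(2,0,0),(0,2,0),(2,2,0),(1,1,-1),(1,2,1)`.
[cite: GouveiaRobinsonThomas2013, Ex. 4.5 (p10)] -/
def grtOctahedronVertices : Fin 6 → Fin 3 → ℝ :=
  ![![0, 0, 0], ![2, 0, 0], ![0, 2, 0], ![2, 2, 0], ![1, 1, -1], ![1, 2, 1]]

/-- Facet inequalities `a_jᵀx ≤ b_j` of that octahedron, normals in the printed column order:
`y + z ≥ 0`, `x − z ≥ 0`, `y − 2z ≥ 0`, `x + z ≥ 0`, `2 − x + z ≥ 0`, `2 − x − z ≥ 0`, `2 − y ≥ 0`,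
`2 − y + z ≥ 0` (each facet plane passes through the three vertices at which the column vanishes).
[cite: GouveiaRobinsonThomas2013, Ex. 4.5 (p10)] -/
def grtOctahedronNormals : Fin 8 → Fin 3 → ℝ :=
  ![![0, -1, -1], ![-1, 0, 1], ![0, -1, 2], ![-1, 0, -1], ![1, 0, -1], ![1, 0, 1], ![0, 1, 0],
    ![0, 1, -1]]

/-- Facet inequalities of that octahedron: right-hand sides `0,0,0,0,2,2,2,2`.
[cite: GouveiaRobinsonThomas2013, Ex. 4.5 (p10)] -/
def grtOctahedronOffsets : Fin 8 → ℝ := ![0, 0, 0, 0, 2, 2, 2, 2]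

/-- The printed matrix IS the slack matrix `(b_j − a_jᵀv_i)` of the printed vertices against the eight
inequalities `grtOctahedronNormals`/`grtOctahedronOffsets` (every inequality is valid on all six
vertices and tight on exactly three of them, one from each antipodal pair — the facets of the
octahedron; that these eight ARE all the facets is not used below).
[cite: GouveiaRobinsonThomas2013, Ex. 4.5 (p10)] -/
theorem grtOctahedronSlack_eq_slack (i : Fin 6) (j : Fin 8) :
    grtOctahedronSlack i j = grtOctahedronOffsets j - grtOctahedronNormals j ⬝ᵥ grtOctahedronVertices i := by
  fin_cases i <;> fin_cases j <;>
    simp [grtOctahedronSlack, grtOctahedronN, grtOctahedronOffsets, grtOctahedronNormals,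
      grtOctahedronVertices, dotProduct, Fin.sum_univ_three] <;> norm_num

/-- Zero entries of the slack matrix are read off the natural-number table.
[cite: GouveiaRobinsonThomas2013, Ex. 4.5 (p10)] -/
theorem grtOctahedronSlack_eq_zero_iff (i : Fin 6) (j : Fin 8) :
    grtOctahedronSlack i j = 0 ↔ grtOctahedronN i j = 0 := by
  simp [grtOctahedronSlack]

/-- The slack matrix is entrywise nonnegative. [cite: GouveiaRobinsonThomas2013, Ex. 4.5 (p10)] -/
theorem grtOctahedronSlack_nonneg (i : Fin 6) (j : Fin 8) : 0 ≤ grtOctahedronSlack i j :=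
  Nat.cast_nonneg _

/-- The eight facets as vertex triples (the rows at which each column vanishes): the triangles with
one vertex from each of the antipodal pairs `{0,3}`, `{1,2}`, `{4,5}` — the boundary complex of an
octahedron ("combinatorially equivalent to" the regular octahedron, p10).
[cite: GouveiaRobinsonThomas2013, Ex. 4.5 (p10)] -/
def grtOctahedronFacets : Fin 8 → Fin 3 → Fin 6 :=
  ![![0, 1, 4], ![0, 2, 5], ![0, 1, 5], ![0, 2, 4], ![3, 1, 4], ![3, 1, 5], ![3, 2, 5], ![3, 2, 4]]

/-- The zero pattern of the printed slack matrix is exactly the vertex–facet incidence of the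
octahedron: `S_{ij} = 0` iff vertex `i` lies on facet `j`. [cite: GouveiaRobinsonThomas2013, Ex. 4.5 (p10)] -/
theorem grtOctahedronN_eq_zero_iff (i : Fin 6) (j : Fin 8) :
    grtOctahedronN i j = 0 ↔ ∃ t : Fin 3, grtOctahedronFacets j t = i := by
  revert i j
  decide

/-- Each facet takes exactly one vertex from each antipodal pair `{0,3}`, `{1,2}`, `{4,5}`: vertex `0`
or `3` in position `0`, vertex `1` or `2` in position `1`, vertex `4` or `5` in position `2`, and all
eight such triangles occur. [cite: GouveiaRobinsonThomas2013, Ex. 4.5 (p10)] -/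
theorem grtOctahedronFacets_antipodal :
    (∀ j, (grtOctahedronFacets j 0 = 0 ∨ grtOctahedronFacets j 0 = 3) ∧
      (grtOctahedronFacets j 1 = 1 ∨ grtOctahedronFacets j 1 = 2) ∧
      (grtOctahedronFacets j 2 = 4 ∨ grtOctahedronFacets j 2 = 5)) ∧
    Function.Injective grtOctahedronFacets := by
  refine ⟨by decide, ?_⟩
  decide

/-! ### `rank S = 4` -/

/-- `S = [1 | v_i] · [b_j ; −a_j]`: the slack matrix factors through `ℝ⁴` (row factor).
[cite: GouveiaRobinsonThomas2013, Ex. 4.5 (p10)] -/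
def grtOctahedronRowFactor : Matrix (Fin 6) (Fin 4) ℝ :=
  Matrix.of fun i => ![1, grtOctahedronVertices i 0, grtOctahedronVertices i 1, grtOctahedronVertices i 2]

/-- `S = [1 | v_i] · [b_j ; −a_j]`: the column factor. [cite: GouveiaRobinsonThomas2013, Ex. 4.5 (p10)] -/
def grtOctahedronColFactor : Matrix (Fin 4) (Fin 8) ℝ :=
  Matrix.of fun l j => ![grtOctahedronOffsets j, -grtOctahedronNormals j 0, -grtOctahedronNormals j 1,
    -grtOctahedronNormals j 2] l

/-- The rank factorization `S = [1 | v_i] · [b_j ; −a_j]` through `ℝ⁴`.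
[cite: GouveiaRobinsonThomas2013, Ex. 4.5 (p10)] -/
theorem grtOctahedronSlack_eq_mul : grtOctahedronSlack = grtOctahedronRowFactor * grtOctahedronColFactor := by
  ext i j
  rw [Matrix.mul_apply, grtOctahedronSlack_eq_slack, Fin.sum_univ_four]
  simp [grtOctahedronRowFactor, grtOctahedronColFactor, dotProduct, Fin.sum_univ_three]
  ring

/-- `rank S = 4` (`≤ 4`: a slack matrix of points in `ℝ³` factors through `ℝ⁴`; `≥ 4`: the lower
triangular `4 × 4` submatrix on rows `(2,4,1,0)` × columns `(0,2,1,4)` has determinant `2·3·2·2 ≠ 0`).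
[cite: GouveiaRobinsonThomas2013, Ex. 4.5 (p10)] -/
theorem rank_grtOctahedronSlack : grtOctahedronSlack.rank = 4 := by
  refine le_antisymm ?_ ?_
  · rw [grtOctahedronSlack_eq_mul]
    exact (Matrix.rank_mul_le_right _ _).trans (Matrix.rank_le_height grtOctahedronColFactor)
  · have hU : grtOctahedronSlack.submatrix (![2, 4, 1, 0] : Fin 4 → Fin 6) (![0, 2, 1, 4] : Fin 4 → Fin 8) =
        !![2, 2, 0, 2; 0, 3, 2, 0; 0, 0, 2, 0; 0, 0, 0, 2] := by
      ext i j
      fin_cases i <;> fin_cases j <;> simp [grtOctahedronSlack, grtOctahedronN]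
    have hT : Matrix.BlockTriangular (!![2, 2, 0, 2; 0, 3, 2, 0; 0, 0, 2, 0; 0, 0, 0, 2] :
        Matrix (Fin 4) (Fin 4) ℝ) id := by
      intro i j hij
      fin_cases i <;> fin_cases j <;> first | exact absurd hij (by decide) | simp
    have hdet : (grtOctahedronSlack.submatrix (![2, 4, 1, 0] : Fin 4 → Fin 6)
        (![0, 2, 1, 4] : Fin 4 → Fin 8)).det ≠ 0 := by
      rw [hU, Matrix.det_of_upperTriangular hT]
      simp [Fin.prod_univ_four]
    simpa using Literature.LinearAlgebra.Matrix.card_le_rank_of_det_submatrix_ne_zero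
      grtOctahedronSlack _ _ hdet

/-! ### The positive Hadamard square root has rank five -/

/-- The positive Hadamard square root of the slack matrix (entries `0, 1, √2, √3`).
[cite: GouveiaRobinsonThomas2013, Ex. 4.5 (p11)] -/
def grtOctahedronSqrt : Matrix (Fin 6) (Fin 8) ℝ :=
  !![0, 0, 0, 0, Real.sqrt 2, Real.sqrt 2, Real.sqrt 2, Real.sqrt 2;
     0, Real.sqrt 2, 0, Real.sqrt 2, 0, 0, Real.sqrt 2, Real.sqrt 2;
     Real.sqrt 2, 0, Real.sqrt 2, 0, Real.sqrt 2, Real.sqrt 2, 0, 0;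
     Real.sqrt 2, Real.sqrt 2, Real.sqrt 2, Real.sqrt 2, 0, 0, 0, 0;
     0, Real.sqrt 2, Real.sqrt 3, 0, 0, Real.sqrt 2, 1, 0;
     Real.sqrt 3, 0, 0, Real.sqrt 2, Real.sqrt 2, 0, 0, 1]

/-- `grtOctahedronSqrt` is the positive Hadamard square root: entrywise `√(S_{ij})`.
[cite: GouveiaRobinsonThomas2013, Ex. 4.5 (p11)] -/
theorem grtOctahedronSqrt_eq_sqrt (i : Fin 6) (j : Fin 8) :
    grtOctahedronSqrt i j = Real.sqrt (grtOctahedronSlack i j) := by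
  fin_cases i <;> fin_cases j <;> simp [grtOctahedronSqrt, grtOctahedronSlack, grtOctahedronN]

/-- `grtOctahedronSqrt` is a Hadamard square root of `S`. [cite: GouveiaRobinsonThomas2013, Ex. 4.5 (p11)] -/
theorem grtOctahedronSqrt_sq (i : Fin 6) (j : Fin 8) :
    grtOctahedronSqrt i j ^ 2 = grtOctahedronSlack i j := by
  rw [grtOctahedronSqrt_eq_sqrt, Real.sq_sqrt (grtOctahedronSlack_nonneg i j)]

/-- Row `4` of the positive square root is `−(row 1) + (row 2) + (row 3)`: the coefficient matrix of
`⁺√S` over its rows `1,2,3,5,6`. [cite: GouveiaRobinsonThomas2013, Ex. 4.5 (p11)] -/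
def grtOctahedronSqrtU : Matrix (Fin 6) (Fin 5) ℝ :=
  !![1, 0, 0, 0, 0; 0, 1, 0, 0, 0; 0, 0, 1, 0, 0; -1, 1, 1, 0, 0; 0, 0, 0, 1, 0; 0, 0, 0, 0, 1]

/-- `⁺√S = U · (rows 1,2,3,5,6 of ⁺√S)`. [cite: GouveiaRobinsonThomas2013, Ex. 4.5 (p11)] -/
theorem grtOctahedronSqrt_eq_mul :
    grtOctahedronSqrt = grtOctahedronSqrtU *
      grtOctahedronSqrt.submatrix (![0, 1, 2, 4, 5] : Fin 5 → Fin 6) id := by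
  ext i j
  fin_cases i <;> fin_cases j <;>
    simp [grtOctahedronSqrt, grtOctahedronSqrtU, Matrix.mul_apply, Fin.sum_univ_five]

/-! ### Every Hadamard square root has rank at least five -/

/-- **"No Hadamard square root of this slack matrix has rank four"** (p11), in the strong form used
here: for EVERY real matrix `N` with `N ∘ N = S` (any signs), the rows `1,2,3,5,6` of `N` are linearly
independent. Proof: the sign-free elimination described in the module docstring (`P − Q = μ`,
`P² = 2μ²`, `Q² = 6μ²` force `μ = 0`). [cite: GouveiaRobinsonThomas2013, Ex. 4.5 (p11)] -/
theorem linearIndependent_rows_of_sq_eq_grtOctahedronSlack (N : Matrix (Fin 6) (Fin 8) ℝ)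
    (hN : ∀ i j, N i j ^ 2 = grtOctahedronSlack i j) :
    LinearIndependent ℝ (fun k : Fin 5 => N ((![0, 1, 2, 4, 5] : Fin 5 → Fin 6) k)) := by
  rw [Fintype.linearIndependent_iff]
  intro g hg
  -- the eight column equations
  have hcol : ∀ j, g 0 * N 0 j + g 1 * N 1 j + g 2 * N 2 j + g 3 * N 4 j + g 4 * N 5 j = 0 := by
    intro j
    have := congrFun hg j
    simpa [Fin.sum_univ_five] using this
  -- entries: zeros and squares
  have hsq : ∀ i j, N i j ^ 2 = (grtOctahedronN i j : ℝ) := hN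
  have hz : ∀ i j, grtOctahedronN i j = 0 → N i j = 0 := fun i j h => by
    have := hsq i j
    rw [h, Nat.cast_zero] at this
    exact (pow_eq_zero_iff two_ne_zero).mp this
  have z00 : N 0 0 = 0 := hz 0 0 (by decide)
  have z01 : N 0 1 = 0 := hz 0 1 (by decide)
  have z02 : N 0 2 = 0 := hz 0 2 (by decide)
  have z03 : N 0 3 = 0 := hz 0 3 (by decide)
  have z10 : N 1 0 = 0 := hz 1 0 (by decide)
  have z12 : N 1 2 = 0 := hz 1 2 (by decide)
  have z14 : N 1 4 = 0 := hz 1 4 (by decide)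
  have z15 : N 1 5 = 0 := hz 1 5 (by decide)
  have z21 : N 2 1 = 0 := hz 2 1 (by decide)
  have z23 : N 2 3 = 0 := hz 2 3 (by decide)
  have z26 : N 2 6 = 0 := hz 2 6 (by decide)
  have z27 : N 2 7 = 0 := hz 2 7 (by decide)
  have z40 : N 4 0 = 0 := hz 4 0 (by decide)
  have z43 : N 4 3 = 0 := hz 4 3 (by decide)
  have z44 : N 4 4 = 0 := hz 4 4 (by decide)
  have z47 : N 4 7 = 0 := hz 4 7 (by decide)
  have z51 : N 5 1 = 0 := hz 5 1 (by decide)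
  have z52 : N 5 2 = 0 := hz 5 2 (by decide)
  have z55 : N 5 5 = 0 := hz 5 5 (by decide)
  have z56 : N 5 6 = 0 := hz 5 6 (by decide)
  have e20 : N 2 0 ^ 2 = 2 := by rw [hsq]; simp [grtOctahedronN]
  have e50 : N 5 0 ^ 2 = 3 := by rw [hsq]; simp [grtOctahedronN]
  have e11 : N 1 1 ^ 2 = 2 := by rw [hsq]; simp [grtOctahedronN]
  have e41 : N 4 1 ^ 2 = 2 := by rw [hsq]; simp [grtOctahedronN]
  have e22 : N 2 2 ^ 2 = 2 := by rw [hsq]; simp [grtOctahedronN]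
  have e42 : N 4 2 ^ 2 = 3 := by rw [hsq]; simp [grtOctahedronN]
  have e13 : N 1 3 ^ 2 = 2 := by rw [hsq]; simp [grtOctahedronN]
  have e53 : N 5 3 ^ 2 = 2 := by rw [hsq]; simp [grtOctahedronN]
  have e04 : N 0 4 ^ 2 = 2 := by rw [hsq]; simp [grtOctahedronN]
  have e24 : N 2 4 ^ 2 = 2 := by rw [hsq]; simp [grtOctahedronN]
  have e54 : N 5 4 ^ 2 = 2 := by rw [hsq]; simp [grtOctahedronN]
  have e06 : N 0 6 ^ 2 = 2 := by rw [hsq]; simp [grtOctahedronN]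
  have e16 : N 1 6 ^ 2 = 2 := by rw [hsq]; simp [grtOctahedronN]
  have e46 : N 4 6 ^ 2 = 1 := by rw [hsq]; simp [grtOctahedronN]
  -- name the coefficients
  obtain ⟨α, hα⟩ : ∃ α, α = g 0 := ⟨_, rfl⟩
  obtain ⟨β, hβ⟩ : ∃ β, β = g 1 := ⟨_, rfl⟩
  obtain ⟨γ, hγ⟩ : ∃ γ, γ = g 2 := ⟨_, rfl⟩
  obtain ⟨ε, hε⟩ : ∃ ε, ε = g 3 := ⟨_, rfl⟩
  obtain ⟨ζ, hζ⟩ : ∃ ζ, ζ = g 4 := ⟨_, rfl⟩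
  rw [← hα, ← hβ, ← hγ, ← hε, ← hζ] at hcol
  -- the six column equations used
  have c0 : γ * N 2 0 + ζ * N 5 0 = 0 := by have := hcol 0; rw [z00, z10, z40] at this; linarith
  have c1 : β * N 1 1 + ε * N 4 1 = 0 := by have := hcol 1; rw [z01, z21, z51] at this; linarith
  have c2 : γ * N 2 2 + ε * N 4 2 = 0 := by have := hcol 2; rw [z02, z12, z52] at this; linarith
  have c3 : β * N 1 3 + ζ * N 5 3 = 0 := by have := hcol 3; rw [z03, z23, z43] at this; linarith
  have c4 : α * N 0 4 + γ * N 2 4 + ζ * N 5 4 = 0 := by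
    have := hcol 4; rw [z14, z44] at this; linarith
  have c6 : α * N 0 6 + β * N 1 6 + ε * N 4 6 = 0 := by
    have := hcol 6; rw [z26, z56] at this; linarith
  -- squares of the two-term equations
  have r1 : 2 * γ ^ 2 = 3 * ζ ^ 2 := by
    have h : (γ * N 2 0) ^ 2 = (ζ * N 5 0) ^ 2 := by
      rw [show γ * N 2 0 = -(ζ * N 5 0) by linarith]; ring
    rw [mul_pow, mul_pow, e20, e50] at h; linarith
  have r2 : γ ^ 2 = 3 / 2 * ε ^ 2 := by
    have h : (γ * N 2 2) ^ 2 = (ε * N 4 2) ^ 2 := by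
      rw [show γ * N 2 2 = -(ε * N 4 2) by linarith]; ring
    rw [mul_pow, mul_pow, e22, e42] at h; linarith
  have r3 : β ^ 2 = ε ^ 2 := by
    have h : (β * N 1 1) ^ 2 = (ε * N 4 1) ^ 2 := by
      rw [show β * N 1 1 = -(ε * N 4 1) by linarith]; ring
    rw [mul_pow, mul_pow, e11, e41] at h; linarith
  have r4 : ζ ^ 2 = ε ^ 2 := by linarith
  -- `P := β ε N₁₆ N₄₆`, `Q := γ ζ N₂₄ N₅₄`
  obtain ⟨P, hP⟩ : ∃ P, P = β * ε * N 1 6 * N 4 6 := ⟨_, rfl⟩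
  obtain ⟨Q, hQ⟩ : ∃ Q, Q = γ * ζ * N 2 4 * N 5 4 := ⟨_, rfl⟩
  have hP2 : P ^ 2 = 2 * (ε ^ 2) ^ 2 := by
    have : P ^ 2 = β ^ 2 * ε ^ 2 * N 1 6 ^ 2 * N 4 6 ^ 2 := by rw [hP]; ring
    rw [this, e16, e46, r3]; ring
  have hQ2 : Q ^ 2 = 6 * (ε ^ 2) ^ 2 := by
    have : Q ^ 2 = γ ^ 2 * ζ ^ 2 * N 2 4 ^ 2 * N 5 4 ^ 2 := by rw [hQ]; ring
    rw [this, e24, e54, r4, r2]; ring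
  -- column 7 (index 6): `2α² = 3ε² + 2P`; column 5 (index 4): `2α² = 5ε² + 2Q`
  have hA1 : 2 * α ^ 2 = 3 * ε ^ 2 + 2 * P := by
    have h : (α * N 0 6) ^ 2 = (β * N 1 6 + ε * N 4 6) ^ 2 := by
      rw [show α * N 0 6 = -(β * N 1 6 + ε * N 4 6) by linarith]; ring
    have h' : α ^ 2 * N 0 6 ^ 2 = β ^ 2 * N 1 6 ^ 2 + ε ^ 2 * N 4 6 ^ 2 + 2 * P := by
      rw [hP]; linear_combination h
    rw [e06, e16, e46, r3] at h'
    linarith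
  have hA2 : 2 * α ^ 2 = 5 * ε ^ 2 + 2 * Q := by
    have h : (α * N 0 4) ^ 2 = (γ * N 2 4 + ζ * N 5 4) ^ 2 := by
      rw [show α * N 0 4 = -(γ * N 2 4 + ζ * N 5 4) by linarith]; ring
    have h' : α ^ 2 * N 0 4 ^ 2 = γ ^ 2 * N 2 4 ^ 2 + ζ ^ 2 * N 5 4 ^ 2 + 2 * Q := by
      rw [hQ]; linear_combination h
    rw [e04, e24, e54, r4, r2] at h'
    linarith
  have hPQ : P - Q = ε ^ 2 := by linarith
  -- elimination: `2PQ = 7ε⁴`, `48ε⁸ = 49ε⁸`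
  have hsq' : (P - Q) ^ 2 = (ε ^ 2) ^ 2 := by rw [hPQ]
  have h1 : 2 * P * Q = 7 * (ε ^ 2) ^ 2 := by linear_combination hP2 + hQ2 - hsq'
  have h49 : (2 * P * Q) ^ 2 = 49 * (ε ^ 2) ^ 4 := by rw [h1]; ring
  have h48 : (2 * P * Q) ^ 2 = 48 * (ε ^ 2) ^ 4 := by
    have : (2 * P * Q) ^ 2 = 4 * P ^ 2 * Q ^ 2 := by ring
    rw [this, hP2, hQ2]; ring
  have hε0 : ε = 0 := by
    have h8 : (ε ^ 2) ^ 4 = 0 := by linarith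
    have h2 : ε ^ 2 = 0 := (pow_eq_zero_iff (by norm_num : (4 : ℕ) ≠ 0)).mp h8
    exact (pow_eq_zero_iff two_ne_zero).mp h2
  have hβ0 : β = 0 := (pow_eq_zero_iff two_ne_zero).mp (by rw [r3, hε0]; ring)
  have hζ0 : ζ = 0 := (pow_eq_zero_iff two_ne_zero).mp (by rw [r4, hε0]; ring)
  have hγ0 : γ = 0 := (pow_eq_zero_iff two_ne_zero).mp (by rw [r2, hε0]; ring)
  have hα0 : α = 0 := by
    have h : α * N 0 4 = 0 := by rw [hγ0, hζ0] at c4; linarith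
    rcases mul_eq_zero.mp h with h | h
    · exact h
    · exfalso; rw [h] at e04; norm_num at e04
  intro k
  fin_cases k
  · simpa [← hα] using hα0
  · simpa [← hβ] using hβ0
  · simpa [← hγ] using hγ0
  · simpa [← hε] using hε0
  · simpa [← hζ] using hζ0

/-- Hence every Hadamard square root of `S` has rank `≥ 5` ("no Hadamard square root of this slack
matrix has rank four", p11). [cite: GouveiaRobinsonThomas2013, Ex. 4.5 (p11)] -/
theorem five_le_rank_of_sq_eq_grtOctahedronSlack (N : Matrix (Fin 6) (Fin 8) ℝ)
    (hN : ∀ i j, N i j ^ 2 = grtOctahedronSlack i j) : 5 ≤ N.rank := by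
  have hli := linearIndependent_rows_of_sq_eq_grtOctahedronSlack N hN
  have h5 : (N.submatrix (![0, 1, 2, 4, 5] : Fin 5 → Fin 6) id).rank = 5 := by
    have := LinearIndependent.rank_matrix
      (M := N.submatrix (![0, 1, 2, 4, 5] : Fin 5 → Fin 6) id) (by exact hli)
    simpa using this
  calc 5 = (N.submatrix (![0, 1, 2, 4, 5] : Fin 5 → Fin 6) id).rank := h5.symm
    _ ≤ N.rank := Matrix.rank_submatrix_le N _ _

/-- In the tree's vocabulary: `rank_√ S ≥ 5`, i.e. `S` has NO Hadamard square root of rank `≤ 4`.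
[cite: GouveiaRobinsonThomas2013, Ex. 4.5 (p11)] -/
theorem not_hasHadamardSqrtOfRankLE_grtOctahedronSlack_four :
    ¬ HasHadamardSqrtOfRankLE grtOctahedronSlack 4 := by
  rintro ⟨N, hN, hr⟩
  have := five_le_rank_of_sq_eq_grtOctahedronSlack N hN
  omega

/-- **"the positive Hadamard square root has rank five"** (p11): `≤ 5` by the row relation
`r₄ = −r₁ + r₂ + r₃`, `≥ 5` by the preceding theorem. [cite: GouveiaRobinsonThomas2013, Ex. 4.5 (p11)] -/
theorem rank_grtOctahedronSqrt : grtOctahedronSqrt.rank = 5 := by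
  refine le_antisymm ?_ (five_le_rank_of_sq_eq_grtOctahedronSlack _ grtOctahedronSqrt_sq)
  rw [grtOctahedronSqrt_eq_mul]
  exact (Matrix.rank_mul_le_right _ _).trans (Matrix.rank_le_height _)

/-! ### Psd rank five -/

/-- In a psd factorization of SIZE FOUR of `S`, every factor has rank `≤ 1`: for each row (column)
there is a triangular `3`-pattern inside the columns (rows) where it vanishes, and GRT Prop. 2.6's
compression gives `rank + 3 ≤ 4` (for the genuine slack matrix this is GRT Prop. 3.2: vertex rows and
facet columns of a psd-minimal polytope have rank-one factors). The fourteen patterns are listed in the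
proof. [cite: GouveiaRobinsonThomas2013, Ex. 4.5 (p10–p11) with Prop. 2.6 / Prop. 3.2 (p05–p07)] -/
theorem grtOctahedronSlack_factors_rank_le_one (A : Fin 6 → Matrix (Fin 4) (Fin 4) ℝ)
    (B : Fin 8 → Matrix (Fin 4) (Fin 4) ℝ) (hA : ∀ i, (A i).PosSemidef) (hB : ∀ j, (B j).PosSemidef)
    (hM : ∀ i j, grtOctahedronSlack i j = (A i * B j).trace) :
    (∀ i, (A i).rank ≤ 1) ∧ ∀ j, (B j).rank ≤ 1 := by
  have row : ∀ (r : Fin 6) (ρ : Fin 3 → Fin 6) (γ : Fin 3 → Fin 8),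
      (∀ a, grtOctahedronN r (γ a) = 0) → (∀ a, grtOctahedronN (ρ a) (γ a) ≠ 0) →
      (∀ a b, a < b → grtOctahedronN (ρ a) (γ b) = 0) → (A r).rank ≤ 1 := by
    intro r ρ γ h1 h2 h3
    have h := rank_rowFactor_add_le_of_triangular A B hA hB hM r ρ γ
      (fun a => (grtOctahedronSlack_eq_zero_iff _ _).mpr (h1 a))
      (fun a ha => h2 a ((grtOctahedronSlack_eq_zero_iff _ _).mp ha))
      (fun a b hab => (grtOctahedronSlack_eq_zero_iff _ _).mpr (h3 a b hab))
    omega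
  have col : ∀ (c : Fin 8) (ρ : Fin 3 → Fin 6) (γ : Fin 3 → Fin 8),
      (∀ a, grtOctahedronN (ρ a) c = 0) → (∀ a, grtOctahedronN (ρ a) (γ a) ≠ 0) →
      (∀ a b, a < b → grtOctahedronN (ρ a) (γ b) = 0) → (B c).rank ≤ 1 := by
    intro c ρ γ h1 h2 h3
    have h := rank_colFactor_add_le_of_triangular A B hA hB hM c ρ γ
      (fun a => (grtOctahedronSlack_eq_zero_iff _ _).mpr (h1 a))
      (fun a ha => h2 a ((grtOctahedronSlack_eq_zero_iff _ _).mp ha))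
      (fun a b hab => (grtOctahedronSlack_eq_zero_iff _ _).mpr (h3 a b hab))
    omega
  refine ⟨fun i => ?_, fun j => ?_⟩
  · fin_cases i
    · exact row 0 ![5, 1, 2] ![0, 1, 2] (by decide) (by decide) (by decide)
    · exact row 1 ![5, 3, 0] ![0, 2, 5] (by decide) (by decide) (by decide)
    · exact row 2 ![4, 3, 0] ![1, 3, 7] (by decide) (by decide) (by decide)
    · exact row 3 ![5, 2, 0] ![4, 5, 6] (by decide) (by decide) (by decide)
    · exact row 4 ![2, 3, 0] ![0, 3, 7] (by decide) (by decide) (by decide)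
    · exact row 5 ![1, 3, 0] ![1, 2, 5] (by decide) (by decide) (by decide)
  · fin_cases j
    · exact col 0 ![0, 1, 4] ![4, 1, 2] (by decide) (by decide) (by decide)
    · exact col 1 ![0, 2, 5] ![4, 0, 3] (by decide) (by decide) (by decide)
    · exact col 2 ![0, 1, 5] ![4, 1, 0] (by decide) (by decide) (by decide)
    · exact col 3 ![0, 2, 4] ![4, 0, 1] (by decide) (by decide) (by decide)
    · exact col 4 ![1, 3, 4] ![1, 0, 5] (by decide) (by decide) (by decide)
    · exact col 5 ![1, 3, 5] ![1, 0, 4] (by decide) (by decide) (by decide)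
    · exact col 6 ![2, 3, 5] ![0, 1, 7] (by decide) (by decide) (by decide)
    · exact col 7 ![2, 3, 4] ![0, 1, 6] (by decide) (by decide) (by decide)

/-- **`rank_psd S ≥ 5`**: `S` has no psd factorization of size `4` (rank-one factors would give a
Hadamard square root of rank `≤ 4`, Lemma 2.4 = FGPRT Prop. 6.2, contradicting
`not_hasHadamardSqrtOfRankLE_grtOctahedronSlack_four`). [cite: GouveiaRobinsonThomas2013, Ex. 4.5 (p11)] -/
theorem not_hasPsdFactorization_grtOctahedronSlack_four : ¬ HasPsdFactorization grtOctahedronSlack 4 := by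
  rintro ⟨A, B, hA, hB, hM⟩
  obtain ⟨hAr, hBr⟩ := grtOctahedronSlack_factors_rank_le_one A B hA hB hM
  exact not_hasHadamardSqrtOfRankLE_grtOctahedronSlack_four
    (FawziEtAl2015_prop62_holds (Fin 6) (Fin 8) grtOctahedronSlack 4
      ⟨A, B, fun i => ⟨hA i, hAr i⟩, fun j => ⟨hB j, hBr j⟩, hM⟩)

/-- **`rank_psd S ≤ 5`**: the positive square root of rank five gives a psd factorization of size `5`
by rank-one factors (Prop. 2.2 = FGPRT Cor. 5.3). [cite: GouveiaRobinsonThomas2013, Ex. 4.5 (p11)] -/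
theorem hasPsdFactorization_grtOctahedronSlack_five : HasPsdFactorization grtOctahedronSlack 5 :=
  HasHadamardSqrtOfRankLE.hasPsdFactorization ⟨grtOctahedronSqrt, grtOctahedronSqrt_sq,
    rank_grtOctahedronSqrt.le⟩

/-- **GRT Example 4.5, "the psd rank of this octahedron is five"**: `rank_psd S = 5` exactly — a psd
factorization of size `5` exists and none of size `≤ 4` (whereas `rank S = 4 = dim + 1`, so the
octahedron is NOT psd-minimal). [cite: GouveiaRobinsonThomas2013, Ex. 4.5 (p10–p11)] -/
theorem grtOctahedronSlack_psdRank :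
    HasPsdFactorization grtOctahedronSlack 5 ∧ ∀ k, HasPsdFactorization grtOctahedronSlack k → 5 ≤ k := by
  refine ⟨hasPsdFactorization_grtOctahedronSlack_five, fun k hk => ?_⟩
  by_contra hlt
  exact not_hasPsdFactorization_grtOctahedronSlack_four (hk.mono (by omega))

/-- The zero pattern of `S` has a triangular `4`-pattern (rows `(0,1,4,2)` × columns `(4,1,2,0)`) but,
as one checks by exhausting the `6 × 8` incidence, no triangular `5`-pattern: the support-based lower
bound for this octahedron is `4`; typed is the `4`-pattern, giving `rank_psd ≥ 4` for EVERY nonnegative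
matrix with this zero pattern. [cite: GouveiaRobinsonThomas2013, Ex. 4.5 (p10–p11); Remark 3.3 (p07)] -/
theorem four_le_of_hasPsdFactorization_of_support_octahedron {M : Fin 6 → Fin 8 → ℝ}
    (hM : ∀ i j, M i j = 0 ↔ grtOctahedronN i j = 0) {k : ℕ} (h : HasPsdFactorization M k) : 4 ≤ k :=
  h.card_le_of_triangular ![0, 1, 4, 2] ![4, 1, 2, 0]
    (fun a ha => by
      have h' : ∀ a : Fin 4, grtOctahedronN (![0, 1, 4, 2] a) (![4, 1, 2, 0] a) ≠ 0 := by decide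
      exact h' a ((hM _ _).mp ha))
    (fun a b hab => (hM _ _).mpr (by
      have h' : ∀ a b : Fin 4, a < b → grtOctahedronN (![0, 1, 4, 2] a) (![4, 1, 2, 0] b) = 0 := by
        decide
      exact h' a b hab))

/-! ### The regular octahedron: same combinatorial type, `2`-level, psd rank four -/

/-- The regular octahedron `conv{±e₁, ±e₂, ±e₃}`, vertices listed so that vertex `i` corresponds to
vertex `i` of Example 4.5 under the combinatorial equivalence (`0 ↦ e₁, 1 ↦ e₂, 2 ↦ −e₂, 3 ↦ −e₁,
4 ↦ e₃, 5 ↦ −e₃`). [cite: GouveiaRobinsonThomas2013, Ex. 4.5 (p10, "The regular octahedron in ℝ³ is a 2-level polytope")] -/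
def regOctahedronVertices : Fin 6 → Fin 3 → ℝ :=
  ![![1, 0, 0], ![0, 1, 0], ![0, -1, 0], ![-1, 0, 0], ![0, 0, 1], ![0, 0, -1]]

/-- The facet inequalities `σᵀx ≤ 1`, `σ ∈ {±1}³`, of the regular octahedron, listed so that facet `j`
corresponds to facet `j` of Example 4.5. [cite: GouveiaRobinsonThomas2013, Ex. 4.5 (p10)] -/
def regOctahedronNormals : Fin 8 → Fin 3 → ℝ :=
  ![![1, 1, 1], ![1, -1, -1], ![1, 1, -1], ![1, -1, 1], ![-1, 1, 1], ![-1, 1, -1], ![-1, -1, -1],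
    ![-1, -1, 1]]

/-- The slack matrix `1 − σ_jᵀv_i` of the regular octahedron. [cite: GouveiaRobinsonThomas2013, Ex. 4.5 (p10)] -/
def regOctahedronSlack : Matrix (Fin 6) (Fin 8) ℝ :=
  fun i j => 1 - regOctahedronNormals j ⬝ᵥ regOctahedronVertices i

/-- The regular octahedron's slack matrix is `2`-valued off its zeros, with the SAME zero pattern as
Example 4.5's: entry `0` where `grtOctahedronN` vanishes and `2` elsewhere.
[cite: GouveiaRobinsonThomas2013, Ex. 4.5 (p10)] -/
theorem regOctahedronSlack_eq (i : Fin 6) (j : Fin 8) :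
    regOctahedronSlack i j = if grtOctahedronN i j = 0 then 0 else 2 := by
  fin_cases i <;> fin_cases j <;>
    simp [regOctahedronSlack, regOctahedronNormals, regOctahedronVertices, grtOctahedronN,
      dotProduct, Fin.sum_univ_three] <;> norm_num

/-- "The regular octahedron in `ℝ³` is a `2`-level polytope" (p10): every facet functional takes two
values on the vertices, i.e. each column of the slack matrix is `0/2`-valued.
[cite: GouveiaRobinsonThomas2013, Ex. 4.5 (p10); Def. of 2-level (p09)] -/
theorem regOctahedronSlack_two_level (i : Fin 6) (j : Fin 8) :
    regOctahedronSlack i j = 0 ∨ regOctahedronSlack i j = 2 := by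
  rw [regOctahedronSlack_eq]; split_ifs <;> simp

/-- Example 4.5's octahedron is "combinatorially equivalent to" the regular octahedron (p10): under the
chosen labelling the two slack matrices have the same zero pattern (the same vertex–facet incidences).
[cite: GouveiaRobinsonThomas2013, Ex. 4.5 (p10)] -/
theorem regOctahedronSlack_eq_zero_iff (i : Fin 6) (j : Fin 8) :
    regOctahedronSlack i j = 0 ↔ grtOctahedronSlack i j = 0 := by
  rw [regOctahedronSlack_eq, grtOctahedronSlack_eq_zero_iff]
  split_ifs with h <;> simp [h]

/-- The regular octahedron is psd-minimal: `rank_psd = 4 = 3 + 1` (`≤ 4`: the `2`-level slack matrix is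
the Hadamard square of `(1 − σ_jᵀv_i)/√2 = ⟨(1,v_i), (1,−σ_j)/√2⟩`, a factorization through `ℝ⁴`,
FGPRT Thm 2.9 (v) / GRT Cor. 4.2 "2-level polytopes have minimal psd rank"; `≥ 4`: the triangular
`4`-pattern of the common support) — while Example 4.5's octahedron of the same combinatorial type has
psd rank `5`. [cite: GouveiaRobinsonThomas2013, Ex. 4.5 (p10) with Cor. 4.2 (p10)] -/
theorem regOctahedronSlack_psdRank :
    HasPsdFactorization regOctahedronSlack 4 ∧ ∀ k, HasPsdFactorization regOctahedronSlack k → 4 ≤ k := by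
  refine ⟨?_, fun k hk => four_le_of_hasPsdFactorization_of_support_octahedron
    (fun i j => (regOctahedronSlack_eq_zero_iff i j).trans (grtOctahedronSlack_eq_zero_iff i j)) hk⟩
  -- the factorization `S_{ij} = ⟨a_i, b_j⟩²` with `a_i = (1, v_i)`, `b_j = (1, −σ_j)/√2`
  let a : Fin 6 → Fin 4 → ℝ := fun i =>
    ![1, regOctahedronVertices i 0, regOctahedronVertices i 1, regOctahedronVertices i 2]
  let b : Fin 8 → Fin 4 → ℝ := fun j =>
    ![1 / Real.sqrt 2, -regOctahedronNormals j 0 / Real.sqrt 2, -regOctahedronNormals j 1 / Real.sqrt 2,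
      -regOctahedronNormals j 2 / Real.sqrt 2]
  have hs : Real.sqrt 2 ^ 2 = 2 := Real.sq_sqrt zero_le_two
  have hs0 : Real.sqrt 2 ≠ 0 := by positivity
  have hab : ∀ i j, ∑ l, a i l * b j l = regOctahedronSlack i j / Real.sqrt 2 := by
    intro i j
    simp only [Fin.sum_univ_four, regOctahedronSlack, dotProduct, Fin.sum_univ_three]
    simp [a, b]
    field_simp
    ring
  have h := HasPsdFactorization.hadamardSq (M := fun i j => regOctahedronSlack i j / Real.sqrt 2) a b
    (fun i j => (hab i j).symm)
  have hfun : (fun i j => (regOctahedronSlack i j / Real.sqrt 2) ^ 2) = (regOctahedronSlack : Fin 6 → Fin 8 → ℝ) := by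
    funext i j
    rw [div_pow, hs]
    rcases regOctahedronSlack_two_level i j with h0 | h2
    · rw [h0]; norm_num
    · rw [h2]; norm_num
  rwa [hfun] at h

/-- **GRT Example 4.5 (summary, p10–p11, verbatim claim: "being combinatorially equivalent to a
`2`-level polytope does not imply minimal psd rank … an octahedron whose psd rank is five")**: the
printed slack matrix `S` of the octahedron `(0,0,0),(2,0,0),(0,2,0),(2,2,0),(1,1,−1),(1,2,1)` has
`rank S = 4`, every Hadamard square root of rank `≥ 5`, the positive one of rank exactly `5`, and
`rank_psd S = 5`; the regular octahedron, whose slack matrix has the same zero pattern and is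
`2`-level, has `rank_psd = 4`. [cite: GouveiaRobinsonThomas2013, Ex. 4.5 (p10–p11)] -/
theorem GouveiaRobinsonThomas2013_ex45 :
    grtOctahedronSlack.rank = 4 ∧
    (∀ N : Matrix (Fin 6) (Fin 8) ℝ, (∀ i j, N i j ^ 2 = grtOctahedronSlack i j) → 5 ≤ N.rank) ∧
    grtOctahedronSqrt.rank = 5 ∧
    (HasPsdFactorization grtOctahedronSlack 5 ∧ ∀ k, HasPsdFactorization grtOctahedronSlack k → 5 ≤ k) ∧
    (∀ i j, regOctahedronSlack i j = 0 ↔ grtOctahedronSlack i j = 0) ∧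
    (∀ i j, regOctahedronSlack i j = 0 ∨ regOctahedronSlack i j = 2) ∧
    (HasPsdFactorization regOctahedronSlack 4 ∧ ∀ k, HasPsdFactorization regOctahedronSlack k → 4 ≤ k) :=
  ⟨rank_grtOctahedronSlack, five_le_rank_of_sq_eq_grtOctahedronSlack, rank_grtOctahedronSqrt,
    grtOctahedronSlack_psdRank, regOctahedronSlack_eq_zero_iff, regOctahedronSlack_two_level,
    regOctahedronSlack_psdRank⟩

end Literature.Combinatorics.Optimization
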